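import Mathlib
import Summits.KontsevichZagierPeriods.Zeta5Search.Profile17aCellsA
import Summits.KontsevichZagierPeriods.Zeta5Search.Profile17aCellsB
import Summits.KontsevichZagierPeriods.Zeta5Search.DenomLaw.Profile17bPath
import Summits.KontsevichZagierPeriods.Zeta5Search.DenomLaw.LawA4CoverKit
import HarnessLib

/-!
# ζ(5) search — the `N_p = 17` PROFILE with short blocks `(1,2), (1,3), (1,4), (1,5)` for EVERY sorted parameter vector: THEOREM A⁗ `−9` in the frame `(8, [1,−5,−5,1])` ⇒ PATH accounting below `d = 3p`

Cell `pub-zeta5` (HONEST FRAMING: systematic search; no irrationality claim unless certified), TRACK «DENOM-LAW» D1 prover seat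
(denom-prover-d1 g18, `HOME/denom-law/prover-d1/ATTEMPT-18.md` §2).  Seventh general-`b` profile of the first period (after `N_p = 21, 20, 19, 18b, 18a, 17b`):
the `N_p = 17` branch whose short blocks are `(1,2),(1,3),(1,4),(1,5)` — `p ≤ b₇`, `b₀ − b₁ − b₅ < p ≤ min(b₀ − b₁ − b₆, b₀ − b₂ − b₃)` inside the first period.
Then `N_p = 17` (`pairFloors_eq_17a`), `C⋆ ≤ 11`, `p < d < 4p` (`d_bounds17a`), and the node `DenomLaw.PathAccountingFirstPeriod` asks `⌊d/p⌋ − 11`.  Gen 18's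
global census finds: the machine-generated covers `FullProfile.cover17a_ev / cover17a_od` (`Profile17aCells{A,B}`, 26 / 25 types; deep class the centre-free
palindrome `[1,−5,−5,1]` at `−8`, its single raises at `−7`, admissible double raises `[1,−3,−5,1]`, `[1,−5,−3,1]`, `[1,−4,−4,1]` at `−6`) pass the FIVE
clauses of THEOREM A⁗ in the frame `(8, [1,−5,−5,1])` (`DenomLaw.lawA4_of_cover`, spelled-out check by `decide`; the shape clause of THEOREM L5 FAILS here:
`[1,−1,−6,1]` at `−5`), so **`v_p(Cas_j(b)) ≥ 7 − 2M = −9` on the whole profile** (`cas_ge17a_neg9`, every `j`) — the node's value for `⌊d/p⌋ ≤ 2`: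
**`pathAccounting_profile17a`** / **`pathAccountingFirstPeriod_profile17a`** (binders VERBATIM plus the profile inequalities and `d < 3p`), and (CV) on the
WHOLE profile (`profile17aCV`).  OPEN: `3p ≤ d` (node `−8 = 8 − 2M`; census: 54 of 2,989 instances at `p ≤ 11`, exact `v = −8`; THEOREM L5 at frame depth 8
(`lawA5_depth8`) would give it but its shape clause / single-pole side condition fail on these covers — recorded in ATTEMPT-18 §3).
MODEL/structure-side valuation bookkeeping of the cell's own rationals; nothing about ζ(5); no γ; records in print UNMOVED.
-/

open Finset

namespace Summit.KontsevichZagierPeriods.Zeta5Search.FullProfile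

open Summit.KontsevichZagierPeriods.Zeta5Search.ClusterValuation
open Summit.KontsevichZagierPeriods.Zeta5Search.CasoratianValuation (InPolytope shift casoratian pairFloors refund)
open Summit.KontsevichZagierPeriods.Zeta5Search.WedgeDictionary (dOf)
open Summit.KontsevichZagierPeriods.Zeta5Search.ClassTypeCover
open Summit.KontsevichZagierPeriods.Zeta5Search.DenomLaw (cStar FirstPeriod Sorted7 lawA4_of_cover)
open Summit.KontsevichZagierPeriods.Zeta5Search.DenomLaw.FirstPeriodKit (cStar_le_eleven sorted7_chain firstPeriod_pair pairFloors_expand)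
open Summit.KontsevichZagierPeriods.Zeta5Search.StairTS3 (refund_le_pathHead)
open Summit.KontsevichZagierPeriods.Zeta5Search.SortedProfile

section Bounds

variable {b : ℕ → ℤ} {j p : ℕ}

/-- On this profile `p < d(b) < 4p` (lower: `d + b₄ = (b₀−b₁−b₇)+(b₀−b₂−b₆)+(b₀−b₃−b₅) ≥ 3p`, `b₄ ≤ b₁ < 2p`; upper: `3b₀ < 3p + 3b₁ + 3b₅`). -/
theorem d_bounds17a (hs : Sorted7 b) (hP : (p : ℤ) ≤ b 7) (hQ : b 0 < (p : ℤ) + b 1 + b 5) (hQ6 : (p : ℤ) + b 1 + b 6 ≤ b 0)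
    (hQ23 : (p : ℤ) + b 2 + b 3 ≤ b 0) (hF1 : b 1 < 2 * (p : ℤ)) :
    (p : ℤ) < dOf b ∧ dOf b < 4 * (p : ℤ) := by
  obtain ⟨h21, h32, h43, h54, h65, h76⟩ := sorted7_chain hs
  rw [DecompositionWholeCone.dOf_expand]; constructor <;> linarith

/-- **`N_p = 17`** on this profile: the pair digits of `(1,2), (1,3), (1,4), (1,5)` are `0`, the other seventeen are `1`. -/
theorem pairFloors_eq_17a (hb : InPolytope b) (hs : Sorted7 b) (hp : 0 < p) (hQ : b 0 < (p : ℤ) + b 1 + b 5) (hQ6 : (p : ℤ) + b 1 + b 6 ≤ b 0)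
    (hQ23 : (p : ℤ) + b 2 + b 3 ≤ b 0) (hfp : FirstPeriod b p) : pairFloors b p = 17 := by
  obtain ⟨h21, h32, h43, h54, h65, h76⟩ := sorted7_chain hs
  obtain ⟨h0, hb1, hb2, hb3, hb4, -, -, -, hc1⟩ := box hb
  have hp0 : (0 : ℤ) < p := by exact_mod_cast hp
  have one : ∀ z : ℤ, (p : ℤ) ≤ z → z ≤ 2 * (p : ℤ) - 1 → z / (p : ℤ) = 1 := fun z h1 h2 => by
    rw [Int.ediv_eq_iff_of_pos hp0]; constructor <;> linarith
  have z12 : (b 0 - b 1 - b 2) / (p : ℤ) = 0 := Int.ediv_eq_zero_of_lt (by linarith) (by linarith)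
  have z13 : (b 0 - b 1 - b 3) / (p : ℤ) = 0 := Int.ediv_eq_zero_of_lt (by linarith) (by linarith)
  have z14 : (b 0 - b 1 - b 4) / (p : ℤ) = 0 := Int.ediv_eq_zero_of_lt (by linarith) (by linarith)
  have z15 : (b 0 - b 1 - b 5) / (p : ℤ) = 0 := Int.ediv_eq_zero_of_lt (by linarith) (by linarith)
  have U := fun (i k : ℕ) (hi : i < 7) (hk : k < 7) (hik : i < k) => firstPeriod_pair hfp hi hk hik
  rw [pairFloors_expand, z12, z13, z14, z15,
    one _ (by linarith) (U 0 5 (by norm_num) (by norm_num) (by norm_num)), one _ (by linarith) (U 0 6 (by norm_num) (by norm_num) (by norm_num)),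
    one _ (by linarith) (U 1 2 (by norm_num) (by norm_num) (by norm_num)), one _ (by linarith) (U 1 3 (by norm_num) (by norm_num) (by norm_num)),
    one _ (by linarith) (U 1 4 (by norm_num) (by norm_num) (by norm_num)), one _ (by linarith) (U 1 5 (by norm_num) (by norm_num) (by norm_num)),
    one _ (by linarith) (U 1 6 (by norm_num) (by norm_num) (by norm_num)),
    one _ (by linarith) (U 2 3 (by norm_num) (by norm_num) (by norm_num)), one _ (by linarith) (U 2 4 (by norm_num) (by norm_num) (by norm_num)),
    one _ (by linarith) (U 2 5 (by norm_num) (by norm_num) (by norm_num)), one _ (by linarith) (U 2 6 (by norm_num) (by norm_num) (by norm_num)),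
    one _ (by linarith) (U 3 4 (by norm_num) (by norm_num) (by norm_num)), one _ (by linarith) (U 3 5 (by norm_num) (by norm_num) (by norm_num)),
    one _ (by linarith) (U 3 6 (by norm_num) (by norm_num) (by norm_num)), one _ (by linarith) (U 4 5 (by norm_num) (by norm_num) (by norm_num)),
    one _ (by linarith) (U 4 6 (by norm_num) (by norm_num) (by norm_num)), one _ (by linarith) (U 5 6 (by norm_num) (by norm_num) (by norm_num))]
  norm_num

/-- **THEOREM A⁗ on this profile, general `b`**: `v_p(Cas_j(b)) ≥ −9 = 7 − 2M` in the frame `(8, [1,−5,−5,1])` for every sorted `b` in the polytope, every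
admissible `j`, every first-period prime `p ≥ 5` with `b₀ + 2 < p²` on the profile (the five class clauses hold on both covers: `decide`). -/
theorem cas_ge17a_neg9 (hb : InPolytope b) (hs : Sorted7 b) (hbj : InPolytope (shift b j)) (hj1 : 1 ≤ j) (hj7 : j ≤ 7)
    (hprime : p.Prime) (hp5 : 5 ≤ p) (hwin : (b 0 + 2 : ℤ) < (p : ℤ) ^ 2) (hP : (p : ℤ) ≤ b 7) (hQ : b 0 < (p : ℤ) + b 1 + b 5)
    (hQ6 : (p : ℤ) + b 1 + b 6 ≤ b 0) (hQ23 : (p : ℤ) + b 2 + b 3 ≤ b 0) (hF1 : b 1 < 2 * (p : ℤ)) (hF2 : b 0 < 2 * (p : ℤ) + b 6 + b 7)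
    (hcas : casoratian b j ≠ 0) : (-9 : ℤ) ≤ padicValRat p (casoratian b j) := by
  haveI : Fact p.Prime := ⟨hprime⟩
  have hp2 : p % 2 = 1 := Nat.odd_iff.1 (hprime.odd_of_ne_two (by omega))
  obtain ⟨h0, hb1, hb2, hb3, hb4, -, -, -, -⟩ := box hb
  have hpb : (p : ℤ) ≤ b 0 := by linarith
  have hT : ([1, -5, -5, 1] : List ℤ).reverse = [1, -5, -5, 1] := by decide
  rcases Int.emod_two_eq_zero_or_one (b 0) with hr | hr
  · have h := lawA4_of_cover hb hbj hj1 hj7 hprime hp5 hpb hwin (cover17a_ev hb hs hP hQ hQ6 hQ23 hF1 hF2 hp5 hp2 hr) (M := 8)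
      (by norm_num) (by decide) hT (by rw [oddFlag_false hr]; decide) hcas
    simpa using h
  · have h := lawA4_of_cover hb hbj hj1 hj7 hprime hp5 hpb hwin (cover17a_od hb hs hP hQ hQ6 hQ23 hF1 hF2 hp5 hp2 hr) (M := 8)
      (by norm_num) (by decide) hT (by rw [oddFlag_true hr]; decide) hcas
    simpa using h

end Bounds

/-! ## PATH accounting below `d = 3p` and (CV) on the whole profile -/

/-- **`PathAccountingFirstPeriod`'s conclusion on this `N_p = 17` profile (short blocks `(1,2), (1,3), (1,4), (1,5)`) below `d = 3p`, EVERY sorted `b`,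
every direction `j`.** -/
theorem pathAccounting_profile17a (b : ℕ → ℤ) (j p : ℕ) (hb : InPolytope b) (hs : Sorted7 b) (hbj : InPolytope (shift b j))
    (hj1 : 1 ≤ j) (hj7 : j ≤ 7) (hprime : p.Prime) (hp5 : 5 ≤ p) (hwin : (b 0 + 2 : ℤ) < (p : ℤ) ^ 2) (hfp : FirstPeriod b p)
    (hP : (p : ℤ) ≤ b 7) (hQ : b 0 < (p : ℤ) + b 1 + b 5) (hQ6 : (p : ℤ) + b 1 + b 6 ≤ b 0) (hQ23 : (p : ℤ) + b 2 + b 3 ≤ b 0)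
    (hd3 : dOf b < 3 * (p : ℤ)) (hcas : casoratian b j ≠ 0) :
    dOf b / (p : ℤ) - pairFloors b p - min (if 2 ≤ dOf b / (p : ℤ) then (1 : ℤ) else 0) (5 - (cStar b p : ℤ))
      ≤ padicValRat p (casoratian b j) := by
  obtain ⟨hF1, hF2⟩ := fp_bounds hfp
  have hp0 : (0 : ℤ) < p := by exact_mod_cast hprime.pos
  rw [pairFloors_eq_17a hb hs hprime.pos hQ hQ6 hQ23 hfp]
  have hC11 : (cStar b p : ℤ) ≤ 11 := by exact_mod_cast cStar_le_eleven b p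
  have hmin : -6 ≤ min (if 2 ≤ dOf b / (p : ℤ) then (1 : ℤ) else 0) (5 - (cStar b p : ℤ)) :=
    le_min (by split_ifs <;> norm_num) (by linarith)
  have hfd : dOf b / (p : ℤ) < 3 := by rw [Int.ediv_lt_iff_lt_mul hp0]; linarith
  linarith [cas_ge17a_neg9 hb hs hbj hj1 hj7 hprime hp5 hwin hP hQ hQ6 hQ23 hF1 hF2 hcas]

/-- **THE NODE ON THIS `N_p = 17` PROFILE BELOW `d = 3p`, EVERY SORTED `b`: `PathAccountingFirstPeriod` with its binders VERBATIM plus `p ≤ b₇`,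
`b₀ < p + b₁ + b₅`, `p + b₁ + b₆ ≤ b₀`, `p + b₂ + b₃ ≤ b₀` and `d(b) < 3p`.** -/
theorem pathAccountingFirstPeriod_profile17a :
    ∀ (b : ℕ → ℤ) (p : ℕ), InPolytope b → Sorted7 b → InPolytope (shift b 7) →
      p.Prime → 5 ≤ p → (b 0 + 2 : ℤ) < (p : ℤ) ^ 2 → FirstPeriod b p →
      (p : ℤ) ≤ b 7 → b 0 < (p : ℤ) + b 1 + b 5 → (p : ℤ) + b 1 + b 6 ≤ b 0 → (p : ℤ) + b 2 + b 3 ≤ b 0 → dOf b < 3 * (p : ℤ) →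
      casoratian b 7 ≠ 0 →
        dOf b / (p : ℤ) - pairFloors b p - min (if 2 ≤ dOf b / (p : ℤ) then (1 : ℤ) else 0) (5 - (cStar b p : ℤ))
          ≤ padicValRat p (casoratian b 7) :=
  fun b p hb hs hb7 hprime hp5 hwin hfp hP hQ hQ6 hQ23 hd3 hcas =>
    pathAccounting_profile17a b 7 p hb hs hb7 (by norm_num) (by norm_num) hprime hp5 hwin hfp hP hQ hQ6 hQ23 hd3 hcas

/-- **(CV) on the WHOLE profile, every sorted `b`, every `j`** (no hypothesis on `d`: `refund − N_p ≤ −16 ≤ −9`). -/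
theorem profile17aCV (b : ℕ → ℤ) (j p : ℕ) (hb : InPolytope b) (hs : Sorted7 b) (hbj : InPolytope (shift b j))
    (hj1 : 1 ≤ j) (hj7 : j ≤ 7) (hprime : p.Prime) (hp5 : 5 ≤ p) (hwin : (b 0 + 2 : ℤ) < (p : ℤ) ^ 2) (hfp : FirstPeriod b p)
    (hP : (p : ℤ) ≤ b 7) (hQ : b 0 < (p : ℤ) + b 1 + b 5) (hQ6 : (p : ℤ) + b 1 + b 6 ≤ b 0) (hQ23 : (p : ℤ) + b 2 + b 3 ≤ b 0)
    (hcas : casoratian b j ≠ 0) : refund b p - pairFloors b p ≤ padicValRat p (casoratian b j) := by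
  obtain ⟨hF1, hF2⟩ := fp_bounds hfp
  rw [pairFloors_eq_17a hb hs hprime.pos hQ hQ6 hQ23 hfp]
  have hr : refund b p ≤ 1 := min_le_left _ _
  linarith [cas_ge17a_neg9 hb hs hbj hj1 hj7 hprime hp5 hwin hP hQ hQ6 hQ23 hF1 hF2 hcas]

end Summit.KontsevichZagierPeriods.Zeta5Search.FullProfile
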